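import Mathlib
import HarnessLib

/-!
# A twisted involution of a transitive set under an odd-order abelian group has exactly one fixed point

Seat p1 of cell `hodge-kum4` (rung H3), toward the point-count residual of the fixed-locus branch (item stmt-Ventures-19504)
(`Summit.Ventures.HodgeKum4.Kum4FixedPointCountAtKummer`, booking B″): the UNIQUENESS half of the count
«exactly one of the 125 fixed points of `g ∈ Γ ∖ 1` lies on the fixed fourfold `W₀`» is pure group theory
once `Γ(K) ≅ (ℤ/5)⁴` acts transitively on `Fix(g)` and the Kummer involution `ι₀` inverts `Γ`
(`IsKummerFixedDatum.conj_eq_inv`) and fixes `W₀` pointwise: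

* `smul_eq_of_sq_smul_eq` — if `P` is a commutative group of odd order acting on `S` and `r² • x = x`
  then `r • x = x` (`r = (r²)^{(|P|+1)/2}`);
* **`existsUnique_fixedPoint_of_smul_inv`** — if moreover `P` acts TRANSITIVELY on the nonempty `S` and
  `σ : S → S` satisfies `σ (p • x) = p⁻¹ • σ x`, then `σ` has EXACTLY ONE fixed point
  (existence: `q • x₀` with `q² = c`, `σ x₀ = c • x₀`, squaring being onto; uniqueness: two solutions
  differ by an `r` with `r²` in a stabiliser);
* `card_fixedPoints_eq_one` — the same as `Fintype.card {x // σ x = x} = 1`.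

No algebraic geometry here; HONEST FRAMING: a lemma, nothing about `K⁴(A)` is proved in this file.
-/

namespace Summit.Ventures.HodgeKum4

namespace OddTorsor

variable {P S : Type*} [CommGroup P] [Fintype P] [MulAction P S]

/-- In a group of odd order `2m+1`, `r = (r²)^(m+1)`. -/
theorem eq_sq_pow (hodd : Odd (Fintype.card P)) (r : P) :
    r = (r ^ 2) ^ (Fintype.card P / 2 + 1) := by
  obtain ⟨m, hm⟩ := hodd
  have hdiv : Fintype.card P / 2 = m := by omega
  rw [hdiv, ← pow_mul]
  have : 2 * (m + 1) = Fintype.card P + 1 := by omega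
  rw [this, pow_succ, pow_card_eq_one, one_mul]

/-- Squaring is surjective in a commutative group of odd order. -/
theorem exists_sq_eq (hodd : Odd (Fintype.card P)) (c : P) : ∃ q : P, q ^ 2 = c :=
  ⟨c ^ (Fintype.card P / 2 + 1), by rw [← pow_mul, mul_comm, pow_mul]; exact (eq_sq_pow hodd c).symm⟩

/-- If `r² • x = x` for `r` in a commutative group of odd order, then `r • x = x`. -/
theorem smul_eq_of_sq_smul_eq (hodd : Odd (Fintype.card P)) {r : P} {x : S}
    (h : r ^ 2 • x = x) : r • x = x := by
  have key : ∀ n : ℕ, (r ^ 2) ^ n • x = x := by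
    intro n
    induction n with
    | zero => simp
    | succ n ih => rw [pow_succ, mul_smul, h, ih]
  conv_lhs => rw [eq_sq_pow hodd r]
  exact key _

/-- **A twisted involution of a transitive `P`-set, `P` commutative of odd order, has exactly one fixed
point.**  (`σ` need not be an involution: only `σ (p • x) = p⁻¹ • σ x` is used.) -/
theorem existsUnique_fixedPoint_of_smul_inv (hodd : Odd (Fintype.card P)) [Nonempty S]
    (htrans : ∀ x y : S, ∃ p : P, p • x = y) (σ : S → S) (hσ : ∀ (p : P) (x : S), σ (p • x) = p⁻¹ • σ x) :
    ∃! x : S, σ x = x := by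
  obtain ⟨x₀⟩ := ‹Nonempty S›
  obtain ⟨c, hc⟩ := htrans x₀ (σ x₀)
  obtain ⟨q, hq⟩ := exists_sq_eq hodd c
  refine ⟨q • x₀, ?_, ?_⟩
  · -- existence: σ (q • x₀) = q⁻¹ • c • x₀ = q⁻¹ • q² • x₀ = q • x₀
    show σ (q • x₀) = q • x₀
    rw [hσ, ← hc, ← hq, smul_smul, pow_two, inv_mul_cancel_left]
  · -- uniqueness: a fixed point `p • x₀` has `(p⁻¹ q)² • x₀ = x₀`, hence `(p⁻¹ q) • x₀ = x₀`
    intro y hy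
    obtain ⟨p, rfl⟩ := htrans x₀ y
    rw [hσ, ← hc, smul_smul, ← hq] at hy
    -- hy : (p⁻¹ * q ^ 2) • x₀ = p • x₀
    have h2 : (p⁻¹ * q) ^ 2 • x₀ = x₀ := by
      have h3 := congrArg (fun z ↦ p⁻¹ • z) hy
      simp only [smul_smul, inv_mul_cancel, one_smul] at h3
      -- h3 : (p⁻¹ * (p⁻¹ * q ^ 2)) • x₀ = x₀
      have e : (p⁻¹ * q) ^ 2 = p⁻¹ * (p⁻¹ * q ^ 2) := by
        rw [pow_two, pow_two]; simp only [mul_assoc, mul_left_comm]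
      rw [e]; exact h3
    have h4 := smul_eq_of_sq_smul_eq hodd h2
    -- h4 : (p⁻¹ * q) • x₀ = x₀
    calc p • x₀ = p • ((p⁻¹ * q) • x₀) := by rw [h4]
      _ = q • x₀ := by rw [smul_smul, mul_inv_cancel_left]

/-- The same, as a cardinality statement. -/
theorem card_fixedPoints_eq_one [Fintype S] [DecidableEq S] (hodd : Odd (Fintype.card P)) [Nonempty S]
    (htrans : ∀ x y : S, ∃ p : P, p • x = y) (σ : S → S) (hσ : ∀ (p : P) (x : S), σ (p • x) = p⁻¹ • σ x) :
    Fintype.card {x : S // σ x = x} = 1 := by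
  obtain ⟨x, hx, huniq⟩ := existsUnique_fixedPoint_of_smul_inv hodd htrans σ hσ
  rw [Fintype.card_eq_one_iff]
  exact ⟨⟨x, hx⟩, fun ⟨y, hy⟩ ↦ Subtype.ext (huniq y hy)⟩

end OddTorsor

end Summit.Ventures.HodgeKum4
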